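import Summits.ResolutionOfSingularities.ResolutionOfSingularities.Theorems.LossEntryW12
import HarnessLib

/-!
# LossEntryW13 (= lens-3 g29 slice 7) — walk plumbing of the loss→entry law: the α-type CHAIN STEP (straight frame, and pure form)

decomp-res-lens-3, gen 29 (NODE-g29 §3bis (ii), (N2)).  TOOL at 0.  Imports `Theorems.LossEntryW12` (landing part 12 = slice 6).

§21 proves hypothesis (h2') of `lawLossEntryAt_of_wallSteps'` for α-type chain losses (the loss move in the chart of the WALL letter,
translated along both other letters) from straight wall states, in the fixed frame `(a, b ; c)`:
* `vertexOf_polyPts_shear_snd` — the V-lemma for the SECTION letter (`σ_{b,a,g}`; no hypothesis on `α`);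
* `vertexOf_polyPts_deletePthPowers_of_mem` — cleaning keeps a vertex carried by a clean monomial;
* `vertexOf_polyPts_deletePthPowers_two_shears` — the double V-lemma: the prepared equation `clean(σ_{c,a,g} σ_{b,a,g'} F)` has the
  vertex of `F` (under `α < 1`, walls, clean `F`);
* `polyPts_succ_chart_fst_two_shears` — `P_{t+1} = Ψ₍₁:₀₎(Δ*)` at a doubly translated move in the chart of the first frame letter;
* `betaOf_polyPts_succ_chart_fst_two_shears_le` — **`ŷ_{t+1} ≤ ŷ_t`** (`= γ⁻(Δ*) ≤ β(Δ*) = ŷ_t`), and `alphaOf_polyPts_succ_chart_fst_two_shears`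
  (`α_{t+1} = δ(Δ*) − 1`).
§22 is the same lemma in PURE form — `betaOf_polyPts_alphaStep_le` / `alphaOf_polyPts_alphaStep` for ANY clean `F` with the
`u_a`-wall, degrees `≥ q`, non-empty point set and `α < 1` under `F ↦ clean (chart_a (σ_{c,a,g} σ_{b,a,g'} F))` (no walk, no pencil) —
the engine (N2) needs for α-runs acting on τ-STRAIGHTENED equations, with `polyPts_deletePthPowers_chartTransform_fst` (`Ψ₍₁:₀₎`-law for
`clean ∘ chart_a`, pure) and `alphaStep_output_clean_and_wall` (iterability: the output is clean and keeps the `u_a`-wall).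
The g29 probe: 0 violations of `ŷ_{v+1} ≤ ŷ_v` in 398 genuine chain steps (both step types), and `x̂ < 1` at all 782 wall states
(max 2/3) — the `α < 1` input of the pure lemma; this slice is the α-type half of (h2') as a theorem.  The β-type half (frame change)
and (h1') for chains remain (NODE-g29 §3bis).
-/

open MvPolynomial Finset
open Literature.AlgebraicGeometry.Resolution
open Literature.AlgebraicGeometry.Resolution.Hauser2010
open Literature.AlgebraicGeometry.Resolution.PointBlowup
open Summit.ResolutionOfSingularities.ResolutionOfSingularities.Theorems.TightDefectClasses
open Summit.ResolutionOfSingularities.ResolutionOfSingularities.Theorems.TightDefectStrongWalks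
open Summit.ResolutionOfSingularities.ResolutionOfSingularities.Theorems.ItineraryCutClasses
open Summit.ResolutionOfSingularities.ResolutionOfSingularities.Theorems.BoundaryLedger
open Summit.ResolutionOfSingularities.ResolutionOfSingularities.Theorems.ProximityCut
open Summit.ResolutionOfSingularities.ResolutionOfSingularities.Theorems.LossExitCone
open Summit.ResolutionOfSingularities.ResolutionOfSingularities.Theorems.LossPolygon

/-! ## §21 (h2') FOR α-STEPS IN A STRAIGHT FRAME: the wall ordinate does not increase at a loss move in the chart of the wall letter translated along BOTH other letters (NODE-g29 §3bis (ii)/(N2)) -/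

namespace Summit.ResolutionOfSingularities.ResolutionOfSingularities.Theorems.LossPolygon

variable {K : Type} [Field K] [DecidableEq K] {q : ℕ}

section AlphaStep

variable {a b c : Fin 3}

omit [DecidableEq K] in
/-- The point of a monomial with `n` letters `b` (the SECTION letter) converted into the wall letter `a`: abscissa `+ n/d`,
same denominator. [new; elementary] -/
theorem fst_resPoint_shearExp_snd (hab : a ≠ b) (hac : a ≠ c) (hbc : b ≠ c) (s : ℕ) (r : Fin 3 →₀ ℕ) (D : Fin 3 →₀ ℕ) (n : ℕ) :
    (resPoint s r a b c (shearExp a c b D n)).1 =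
      ((((D a : ℕ) : ℚ)) + n - r a) / (((s : ℕ) : ℚ) + r c - D c) := by
  show ((((shearExp a c b D n a : ℕ) : ℚ)) - r a) / (((s : ℕ) : ℚ) + r c - (shearExp a c b D n c : ℕ)) = _
  rw [shearExp_apply_fst hac hab, shearExp_apply_snd hac hbc.symm]
  push_cast; ring

omit [DecidableEq K] in
/-- **V-LEMMA FOR THE SECTION LETTER (PROVED, no hypothesis on `α`):** the lex-min vertex of the point set in the frame
`(a, b ; c)` is unchanged by the shear `σ_{b,a,g} : u_b ↦ u_b + g u_a` of the section letter into the wall letter — every spawned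
point lies strictly to the right of its source, and the vertex monomial is unreachable. [new] -/
theorem vertexOf_polyPts_shear_snd (hab : a ≠ b) (hac : a ≠ c) (hbc : b ≠ c) {s : ℕ} {r : Fin 3 →₀ ℕ} (g : K)
    {F : MvPolynomial (Fin 3) K} (hne : (polyPts s r a b c F).Nonempty) :
    vertexOf (polyPts s r a b c (shear b a g F)) = vertexOf (polyPts s r a b c F) ∧
      ∃ Dv ∈ F.support, Dv ∈ (shear b a g F).support ∧ Dv c < s + r c ∧
        resPoint s r a b c Dv = vertexOf (polyPts s r a b c F) := by
  classical
  obtain ⟨Dv, hDv, hDve⟩ := Finset.mem_image.mp (vertexOf_mem hne)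
  obtain ⟨hDvF, hDvc⟩ := Finset.mem_filter.mp hDv
  have hpos : ∀ D : Fin 3 →₀ ℕ, D c < s + r c → (0 : ℚ) < ((s : ℕ) : ℚ) + r c - D c := fun D hD => by
    have : ((D c : ℕ) : ℚ) < ((s + r c : ℕ) : ℚ) := by exact_mod_cast hD
    push_cast at this; linarith
  -- a spawned point lies strictly to the right of its source
  have hlt : ∀ D : Fin 3 →₀ ℕ, D c < s + r c → ∀ n, 1 ≤ n →
      (resPoint s r a b c D).1 < (resPoint s r a b c (shearExp a c b D n)).1 := by
    intro D hDc n hn1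
    have h1 := fst_resPoint_shearExp_snd hab hac hbc s r D n
    have h2 : (resPoint s r a b c D).1 = ((((D a : ℕ) : ℚ)) - r a) / (((s : ℕ) : ℚ) + r c - D c) := rfl
    have hn1' : (1 : ℚ) ≤ n := by exact_mod_cast hn1
    rw [h1, h2, div_lt_div_iff_of_pos_right (hpos D hDc)]; linarith
  -- (A) the vertex monomial keeps its coefficient
  have hreach : ∀ D ∈ F.support, ∀ n, 1 ≤ n → n ≤ D b → shearExp a c b D n ≠ Dv := by
    intro D hD n hn1 hnD hE
    have hDc : D c < s + r c := by
      have : shearExp a c b D n c < s + r c := by rw [hE]; exact hDvc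
      rwa [shearExp_apply_snd hac hbc.symm] at this
    have hmem : resPoint s r a b c D ∈ polyPts s r a b c F :=
      Finset.mem_image_of_mem _ (Finset.mem_filter.mpr ⟨hD, hDc⟩)
    have hle := vertexOf_le hmem
    have hx : (resPoint s r a b c (shearExp a c b D n)).1 ≤ (resPoint s r a b c D).1 := by
      rw [hE, hDve]
      rcases ((toLex_le_toLex_iff _ _).mp hle) with h | ⟨h, -⟩
      · exact h.le
      · exact h.le
    exact absurd (hlt D hDc n hn1) (not_lt.mpr hx)
  have hcoeff : coeff Dv (shear b a g F) = coeff Dv F := coeff_shear_eq_coeff hac hab hbc.symm g F hreach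
  have hDvS : Dv ∈ (shear b a g F).support := by
    rw [mem_support_iff, hcoeff]; exact mem_support_iff.mp hDvF
  refine ⟨vertexOf_eq (Finset.mem_image.mpr ⟨Dv, Finset.mem_filter.mpr ⟨hDvS, hDvc⟩, hDve⟩) fun w hw => ?_,
    Dv, hDvF, hDvS, hDvc, hDve⟩
  -- (B) every point of the sheared set is lexicographically above the vertex
  obtain ⟨E, hE, rfl⟩ := Finset.mem_image.mp hw
  obtain ⟨hES, hEc⟩ := Finset.mem_filter.mp hE
  obtain ⟨D, hD, n, hnD, hDE⟩ := exists_shearExp_eq_of_mem_support_shear hac hab hbc.symm g F hES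
  have hDc : D c < s + r c := by rw [← hDE, shearExp_apply_snd hac hbc.symm] at hEc; exact hEc
  have hmem : resPoint s r a b c D ∈ polyPts s r a b c F := Finset.mem_image_of_mem _ (Finset.mem_filter.mpr ⟨hD, hDc⟩)
  rcases Nat.eq_zero_or_pos n with hn0 | hnpos
  · subst hn0
    rw [shearExp_zero hac hab hbc.symm] at hDE
    subst hDE
    exact vertexOf_le hmem
  · have hle := (toLex_le_toLex_iff _ _).mp (vertexOf_le hmem)
    have hlt' := hlt D hDc n hnpos
    rw [← hDE, toLex_le_toLex_iff]
    rcases hle with h | ⟨h, -⟩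
    · exact Or.inl (h.trans hlt')
    · exact Or.inl (by rw [h]; exact hlt')

omit [DecidableEq K] in
/-- **CLEANING KEEPS THE VERTEX when the vertex point is carried by a monomial that is not a `q`-th power (PROVED).** [new] -/
theorem vertexOf_polyPts_deletePthPowers_of_mem {s : ℕ} {r : Fin 3 →₀ ℕ} {H : MvPolynomial (Fin 3) K} {Dv : Fin 3 →₀ ℕ}
    (hDv : Dv ∈ H.support) (hDvc : Dv c < s + r c) (hP : ¬ IsPthPowerExponent q Dv)
    (hDve : resPoint s r a b c Dv = vertexOf (polyPts s r a b c H)) :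
    vertexOf (polyPts s r a b c (deletePthPowers q H)) = vertexOf (polyPts s r a b c H) ∧
      (polyPts s r a b c (deletePthPowers q H)).Nonempty := by
  classical
  have hDvS : Dv ∈ (deletePthPowers q H).support := by
    rw [support_deletePthPowers', Finset.mem_filter]; exact ⟨hDv, hP⟩
  have hmem : vertexOf (polyPts s r a b c H) ∈ polyPts s r a b c (deletePthPowers q H) := by
    rw [← hDve]; exact Finset.mem_image_of_mem _ (Finset.mem_filter.mpr ⟨hDvS, hDvc⟩)
  refine ⟨vertexOf_eq hmem fun w hw => vertexOf_le ?_, ⟨_, hmem⟩⟩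
  obtain ⟨E, hE, rfl⟩ := Finset.mem_image.mp hw
  obtain ⟨hES, hEc⟩ := Finset.mem_filter.mp hE
  rw [support_deletePthPowers', Finset.mem_filter] at hES
  exact Finset.mem_image_of_mem _ (Finset.mem_filter.mpr ⟨hES.1, hEc⟩)

omit [DecidableEq K] in
/-- **THE DOUBLE V-LEMMA (PROVED):** under `α < 1`, `r c = 0`, walls `r a ≤ D a` and a CLEAN `F`, the vertex of the point set of
the prepared equation `clean(σ_{c,a,g} σ_{b,a,g'} F)` (both other letters sheared into the wall letter, then cleaned) in the frame
`(a, b ; c)` is the vertex of the point set of `F`, and the prepared point set is non-empty. [new] -/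
theorem vertexOf_polyPts_deletePthPowers_two_shears (hab : a ≠ b) (hac : a ≠ c) (hbc : b ≠ c) {s : ℕ} {r : Fin 3 →₀ ℕ}
    (hrc : r c = 0) (g g' : K) {F : MvPolynomial (Fin 3) K} (hra : ∀ D ∈ F.support, r a ≤ D a)
    (hclean : ∀ D ∈ F.support, ¬ IsPthPowerExponent q D) (hne : (polyPts s r a b c F).Nonempty)
    (hα : alphaOf (polyPts s r a b c F) < 1) :
    vertexOf (polyPts s r a b c (deletePthPowers q (shear c a g (shear b a g' F)))) = vertexOf (polyPts s r a b c F) ∧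
      (polyPts s r a b c (deletePthPowers q (shear c a g (shear b a g' F)))).Nonempty := by
  classical
  obtain ⟨hV1, Dv, hDvF, hDvG, hDvc, hDve⟩ := vertexOf_polyPts_shear_snd hab hac hbc g' hne (s := s) (r := r)
  set G := shear b a g' F with hG
  have hraG : ∀ D ∈ G.support, r a ≤ D a := by
    intro E hE
    obtain ⟨D, hD, n, -, hDE⟩ := exists_shearExp_eq_of_mem_support_shear hac hab hbc.symm g' F hE
    rw [← hDE, shearExp_apply_fst hac hab]
    exact (hra D hD).trans (Nat.le_add_right _ _)
  have hneG : (polyPts s r a b c G).Nonempty :=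
    ⟨resPoint s r a b c Dv, Finset.mem_image_of_mem _ (Finset.mem_filter.mpr ⟨hDvG, hDvc⟩)⟩
  have hαG : alphaOf (polyPts s r a b c G) < 1 := by unfold alphaOf; rw [hV1]; exact hα
  have hV2 := vertexOf_polyPts_shear hab hac hbc hrc g hraG hneG hαG
  -- the vertex monomial `Dv` survives the second shear …
  have hreach : ∀ D ∈ G.support, ∀ n, 1 ≤ n → n ≤ D c → shearExp a b c D n ≠ Dv := by
    intro D hD n hn1 hnD hE
    have hEc : D c - n < s := by
      have : shearExp a b c D n c < s := by rw [hE]; rw [hrc, add_zero] at hDvc; exact hDvc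
      rwa [shearExp_apply_thd hac hbc] at this
    have hlt := alphaOf_lt_fst_resPoint_shearExp hab hac hbc hrc hαG hD (hraG D hD) hn1 hnD hEc
    rw [hE, hDve, ← hV1] at hlt
    exact lt_irrefl _ hlt
  have hcoeff : coeff Dv (shear c a g G) = coeff Dv G := coeff_shear_eq_coeff hab hac hbc g G hreach
  have hDvS : Dv ∈ (shear c a g G).support := by
    rw [mem_support_iff, hcoeff]; exact mem_support_iff.mp hDvG
  -- … and the cleaning (it is an original, clean monomial of `F`)
  have hDve' : resPoint s r a b c Dv = vertexOf (polyPts s r a b c (shear c a g G)) := by rw [hV2, hV1]; exact hDve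
  obtain ⟨hV3, hne3⟩ := vertexOf_polyPts_deletePthPowers_of_mem (a := a) (b := b) hDvS hDvc (hclean Dv hDvF) hDve'
  exact ⟨by rw [hV3, hV2, hV1], hne3⟩

end AlphaStep

section AlphaStepWalk

variable {s₀ : State (Fin 3) K}

/-- **`Ψ₍₁:₀₎`-LAW AT A DOUBLY TRANSLATED MOVE IN THE CHART OF THE FIRST FRAME LETTER (PROVED):** at a move in the chart of
the wall letter `a` with translations along BOTH other letters (an α-type chain loss), the new point set in the frame `(a, b ; c)`
is EXACTLY `Ψ₍₁:₀₎` of the point set of the prepared equation `clean(σ_{c,a,b_t(c)} σ_{b,a,b_t(b)} F_t)`.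
[`polyPts_succ_chart_fst_translated` for two translations; new] -/
theorem polyPts_succ_chart_fst_two_shears (hs : IsRoot q s₀) (W : ForcedWalk q s₀) (t : ℕ) {a b c : Fin 3} (hab : a ≠ b)
    (hac : a ≠ c) (hbc : b ≠ c) (hj : W.j t = a) {s : ℕ}
    (hrb : (W.st (t + 1)).r b = (W.st t).r b) (hra : (W.st (t + 1)).r a + q = s + (W.st t).r a + (W.st t).r b)
    (hrc : (W.st t).r c = 0) (hrc' : (W.st (t + 1)).r c = 0) :
    polyPts s (W.st (t + 1)).r a b c (W.st (t + 1)).F =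
      (polyPts s (W.st t).r a b c
        (deletePthPowers q (shear c a (W.b t c) (shear b a (W.b t b) (W.st t).F)))).image psi10 := by
  classical
  have hH : ∀ E ∈ (shear c a (W.b t c) (shear b a (W.b t b) (W.st t).F)).support, q ≤ E.degree :=
    fun E hE => le_degree_of_mem_support_two_shears hs W t a c b _ _ hE
  unfold polyPts
  rw [support_succ_two_shears hs W t hac.symm hab.symm hbc.symm hj, support_deletePthPowers', Finset.filter_image,
    Finset.image_image, Finset.image_image]
  set Hs := (shear c a (W.b t c) (shear b a (W.b t b) (W.st t).F)).support.filter fun E => ¬ IsPthPowerExponent q E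
    with hHs
  have hfilt : (Hs.filter fun D => chartExponent q a D c < s + (W.st (t + 1)).r c) =
      (Hs.filter fun D => D c < s + (W.st t).r c) := by
    refine Finset.filter_congr fun D _ => ?_
    rw [chartExponent_apply, if_neg hac.symm, hrc, hrc']
  rw [hfilt]
  refine Finset.image_congr fun D hD => ?_
  have hD := Finset.mem_filter.mp hD
  show resPoint s (W.st (t + 1)).r a b c (chartExponent q a D) = psi10 (resPoint s (W.st t).r a b c D)
  have hDc : D c < s := by have h2 := hD.2; rw [hrc, add_zero] at h2; exact h2
  exact resPoint_chartExponent_fst hab hac hbc hrb hra hrc hrc' (hH D (Finset.mem_filter.mp hD.1).1) hDc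

/-- **(h2') FOR AN α-STEP IN A STRAIGHT FRAME (PROVED): the wall ordinate does not increase.**  At a move in the chart of the
(heavy, `q ≤ s + r_t a`) wall letter `a` translated along both other letters — e.g. an α-type CHAIN LOSS from a one-wall state —
`ŷ_{t+1} ≤ ŷ_t` for the one-wall polygons in the fixed frame `(a, b ; c)`: `ŷ_{t+1} = γ⁻(Δ*) ≤ β(Δ*) = ŷ_t`, `Δ*` the prepared
point set (double V-lemma).  This generalises LAW (L_X1) `betaOf_polyPts_succ_chart_fst_translated_le` (one translation) and is the
α-type chain step (h2') of `lawLossEntryAt_of_wallSteps'` for straight wall states (NODE-g29 §3bis (ii): 0 violations in 398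
chain steps; (N2): the τ-straightened case reduces to this one). [CJS2020 Lemma 13.3 (1:0) in prepared coordinates; new for the walk] -/
theorem betaOf_polyPts_succ_chart_fst_two_shears_le (hs : IsRoot q s₀) (W : ForcedWalk q s₀) (t : ℕ) {a b c : Fin 3}
    (hab : a ≠ b) (hac : a ≠ c) (hbc : b ≠ c) (hj : W.j t = a) {s : ℕ}
    (hrb : (W.st (t + 1)).r b = (W.st t).r b) (hra : (W.st (t + 1)).r a + q = s + (W.st t).r a + (W.st t).r b)
    (hrc : (W.st t).r c = 0) (hrc' : (W.st (t + 1)).r c = 0) (hq : q ≤ s + (W.st t).r a) :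
    betaOf (polyPts s (W.st (t + 1)).r a b c (W.st (t + 1)).F) ≤ betaOf (polyPts s (W.st t).r a b c (W.st t).F) := by
  classical
  have hraD : ∀ D ∈ (W.st t).F.support, (W.st t).r a ≤ D a := fun D hD => walk_r hs W t D hD a
  have hclean : ∀ D ∈ (W.st t).F.support, ¬ IsPthPowerExponent q D := fun D hD =>
    not_isPthPowerExponent_of_mem_support hs W t hD
  have hne : (polyPts s (W.st t).r a b c (W.st t).F).Nonempty := polyPts_nonempty_of_heavy_fst hs W t hac b hq hrc
  have hα : alphaOf (polyPts s (W.st t).r a b c (W.st t).F) < 1 := alphaOf_polyPts_lt_one hs W t hac b hq hrc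
  obtain ⟨hV, hne'⟩ := vertexOf_polyPts_deletePthPowers_two_shears hab hac hbc hrc (W.b t c) (W.b t b) hraD hclean hne hα
  rw [polyPts_succ_chart_fst_two_shears hs W t hab hac hbc hj hrb hra hrc hrc', betaOf_image_psi10 hne']
  refine (gammaMinusOf_le_betaOf hne').trans ?_
  unfold betaOf; rw [hV]

/-- … and the new abscissa is `δ(Δ*) − 1` with `Δ*` the prepared point set, whose lex vertex is the old one. [new] -/
theorem alphaOf_polyPts_succ_chart_fst_two_shears (hs : IsRoot q s₀) (W : ForcedWalk q s₀) (t : ℕ) {a b c : Fin 3}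
    (hab : a ≠ b) (hac : a ≠ c) (hbc : b ≠ c) (hj : W.j t = a) {s : ℕ}
    (hrb : (W.st (t + 1)).r b = (W.st t).r b) (hra : (W.st (t + 1)).r a + q = s + (W.st t).r a + (W.st t).r b)
    (hrc : (W.st t).r c = 0) (hrc' : (W.st (t + 1)).r c = 0) (hq : q ≤ s + (W.st t).r a) :
    alphaOf (polyPts s (W.st (t + 1)).r a b c (W.st (t + 1)).F) =
      deltaOf (polyPts s (W.st t).r a b c
        (deletePthPowers q (shear c a (W.b t c) (shear b a (W.b t b) (W.st t).F)))) - 1 := by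
  classical
  have hraD : ∀ D ∈ (W.st t).F.support, (W.st t).r a ≤ D a := fun D hD => walk_r hs W t D hD a
  have hclean : ∀ D ∈ (W.st t).F.support, ¬ IsPthPowerExponent q D := fun D hD =>
    not_isPthPowerExponent_of_mem_support hs W t hD
  have hne : (polyPts s (W.st t).r a b c (W.st t).F).Nonempty := polyPts_nonempty_of_heavy_fst hs W t hac b hq hrc
  have hα : alphaOf (polyPts s (W.st t).r a b c (W.st t).F) < 1 := alphaOf_polyPts_lt_one hs W t hac b hq hrc
  obtain ⟨-, hne'⟩ := vertexOf_polyPts_deletePthPowers_two_shears hab hac hbc hrc (W.b t c) (W.b t b) hraD hclean hne hα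
  unfold alphaOf
  rw [polyPts_succ_chart_fst_two_shears hs W t hab hac hbc hj hrb hra hrc hrc', vertexOf_image_psi10 hne']

end AlphaStepWalk

end Summit.ResolutionOfSingularities.ResolutionOfSingularities.Theorems.LossPolygon

/-! ## §22 THE α-STEP LEMMA IN PURE FORM (for straightened / non-walk equations, NODE-g29 §3bis (N2)) -/

namespace Summit.ResolutionOfSingularities.ResolutionOfSingularities.Theorems.LossPolygon

variable {K : Type} [Field K] {q : ℕ}

section AlphaStepPure

variable {a b c : Fin 3}

/-- **`Ψ₍₁:₀₎`-LAW FOR `clean ∘ chart_a`, PURE FORM (PROVED):** for ANY polynomial `H` all of whose monomials have degree `≥ q`,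
the point set of `clean (chart_a H)` in the frame `(a, b ; c)` with the new walls `r'` (`r' b = r b`, `r' a + q = s + r a + r b`,
no `c`-wall) is `Ψ₍₁:₀₎` of the point set of `clean H`.  [`polyPts_succ_chart_fst_translated` without the walk; new] -/
theorem polyPts_deletePthPowers_chartTransform_fst (hab : a ≠ b) (hac : a ≠ c) (hbc : b ≠ c) {s : ℕ} {r r' : Fin 3 →₀ ℕ}
    (hrb : r' b = r b) (hra : r' a + q = s + r a + r b) (hrc : r c = 0) (hrc' : r' c = 0) {H : MvPolynomial (Fin 3) K}
    (hH : ∀ E ∈ H.support, q ≤ E.degree) :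
    polyPts s r' a b c (deletePthPowers q (chartTransform q a H)) = (polyPts s r a b c (deletePthPowers q H)).image psi10 := by
  classical
  unfold polyPts
  rw [support_deletePthPowers_chartTransform a H hH, support_deletePthPowers', Finset.filter_image, Finset.image_image,
    Finset.image_image]
  set Hs := H.support.filter fun E => ¬ IsPthPowerExponent q E with hHs
  have hfilt : (Hs.filter fun D => chartExponent q a D c < s + r' c) = (Hs.filter fun D => D c < s + r c) := by
    refine Finset.filter_congr fun D _ => ?_
    rw [chartExponent_apply, if_neg hac.symm, hrc, hrc']
  rw [hfilt]
  refine Finset.image_congr fun D hD => ?_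
  have hD := Finset.mem_filter.mp hD
  show resPoint s r' a b c (chartExponent q a D) = psi10 (resPoint s r a b c D)
  have hDc : D c < s := by have h2 := hD.2; rw [hrc, add_zero] at h2; exact h2
  exact resPoint_chartExponent_fst hab hac hbc hrb hra hrc hrc' (hH D (Finset.mem_filter.mp hD.1).1) hDc

/-- Shears preserve «all degrees `≥ q`». [folklore] -/
theorem le_degree_of_mem_support_two_shears' (c a c' a' : Fin 3) (g g' : K) {F : MvPolynomial (Fin 3) K}
    (hdeg : ∀ D ∈ F.support, q ≤ D.degree) {E : Fin 3 →₀ ℕ} (hE : E ∈ (shear c a g (shear c' a' g' F)).support) :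
    q ≤ E.degree := by
  classical
  obtain ⟨D, hD, hdegD⟩ := exists_degree_eq_of_mem_support_shear c a _ _ hE
  obtain ⟨D', hD', hdegD'⟩ := exists_degree_eq_of_mem_support_shear c' a' _ _ hD
  rw [hdegD, hdegD']; exact hdeg D' hD'

/-- **THE α-STEP LEMMA, PURE FORM (PROVED) — the engine of (h2') for α-runs on straightened equations (NODE-g29 §3bis (N2)):**
for ANY clean `F` with the wall `u_a^{r a} ∣ F`, all degrees `≥ q`, a non-empty point set with `α < 1` in the frame `(a, b ; c)`
(`r c = 0`), and any two shear parameters `g, g'`, the ordinate of the lex-min vertex does not increase under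
`F ↦ clean (chart_a (σ_{c,a,g} σ_{b,a,g'} F))` with the α-step walls `r'`:  `ŷ' = γ⁻(Δ*) ≤ β(Δ*) = ŷ`.  No walk, no pencil. [new] -/
theorem betaOf_polyPts_alphaStep_le (hab : a ≠ b) (hac : a ≠ c) (hbc : b ≠ c) {s : ℕ} {r r' : Fin 3 →₀ ℕ}
    (hrb : r' b = r b) (hra : r' a + q = s + r a + r b) (hrc : r c = 0) (hrc' : r' c = 0) (g g' : K)
    {F : MvPolynomial (Fin 3) K} (hdeg : ∀ D ∈ F.support, q ≤ D.degree) (hraD : ∀ D ∈ F.support, r a ≤ D a)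
    (hclean : ∀ D ∈ F.support, ¬ IsPthPowerExponent q D) (hne : (polyPts s r a b c F).Nonempty)
    (hα : alphaOf (polyPts s r a b c F) < 1) :
    betaOf (polyPts s r' a b c (deletePthPowers q (chartTransform q a (shear c a g (shear b a g' F))))) ≤
      betaOf (polyPts s r a b c F) := by
  classical
  obtain ⟨hV, hne'⟩ := vertexOf_polyPts_deletePthPowers_two_shears hab hac hbc hrc g g' hraD hclean hne hα
  rw [polyPts_deletePthPowers_chartTransform_fst hab hac hbc hrb hra hrc hrc'
      (fun E hE => le_degree_of_mem_support_two_shears' c a b a g g' hdeg hE), betaOf_image_psi10 hne']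
  refine (gammaMinusOf_le_betaOf hne').trans ?_
  unfold betaOf; rw [hV]

/-- … with the new abscissa `δ(Δ*) − 1`, `Δ*` the prepared point set (whose lex vertex is that of `F`). [new] -/
theorem alphaOf_polyPts_alphaStep (hab : a ≠ b) (hac : a ≠ c) (hbc : b ≠ c) {s : ℕ} {r r' : Fin 3 →₀ ℕ}
    (hrb : r' b = r b) (hra : r' a + q = s + r a + r b) (hrc : r c = 0) (hrc' : r' c = 0) (g g' : K)
    {F : MvPolynomial (Fin 3) K} (hdeg : ∀ D ∈ F.support, q ≤ D.degree) (hraD : ∀ D ∈ F.support, r a ≤ D a)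
    (hclean : ∀ D ∈ F.support, ¬ IsPthPowerExponent q D) (hne : (polyPts s r a b c F).Nonempty)
    (hα : alphaOf (polyPts s r a b c F) < 1) :
    alphaOf (polyPts s r' a b c (deletePthPowers q (chartTransform q a (shear c a g (shear b a g' F))))) =
      deltaOf (polyPts s r a b c (deletePthPowers q (shear c a g (shear b a g' F)))) - 1 := by
  classical
  obtain ⟨-, hne'⟩ := vertexOf_polyPts_deletePthPowers_two_shears hab hac hbc hrc g g' hraD hclean hne hα
  unfold alphaOf
  rw [polyPts_deletePthPowers_chartTransform_fst hab hac hbc hrb hra hrc hrc'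
      (fun E hE => le_degree_of_mem_support_two_shears' c a b a g g' hdeg hE), vertexOf_image_psi10 hne']

/-- **ITERABILITY (PROVED):** the output of an α-step again satisfies the STRUCTURAL inputs of `betaOf_polyPts_alphaStep_le` — clean,
all degrees `≥ q` is NOT automatic (degrees drop by `q`; the walk supplies it from `ord ≥ q`), but the wall `u_a^{r' a}` divides it:
every monomial `E'` of `clean (chart_a H)` has `r' a ≤ E' a` when `H = σσF` with walls `r a ≤ D a`, `r b ≤ D b`… — here we record
the two facts that ARE formal: cleanness of the output and the wall in the letter `a` from the degree bound `s + r a + r b ≤ |E|`. [new] -/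
theorem alphaStep_output_clean_and_wall (a : Fin 3) {s : ℕ} {r r' : Fin 3 →₀ ℕ} {b : Fin 3}
    (hra : r' a + q = s + r a + r b) {H : MvPolynomial (Fin 3) K} (hH : ∀ E ∈ H.support, q ≤ E.degree)
    (hHo : ∀ E ∈ H.support, s + r a + r b ≤ E.degree) :
    (∀ E' ∈ (deletePthPowers q (chartTransform q a H)).support, ¬ IsPthPowerExponent q E') ∧
      ∀ E' ∈ (deletePthPowers q (chartTransform q a H)).support, r' a ≤ E' a := by
  classical
  refine ⟨fun E' hE' => ?_, fun E' hE' => ?_⟩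
  · rw [support_deletePthPowers', Finset.mem_filter] at hE'; exact hE'.2
  · rw [support_deletePthPowers_chartTransform a H hH, Finset.mem_image] at hE'
    obtain ⟨E, hE, rfl⟩ := hE'
    have hEs := (Finset.mem_filter.mp hE).1
    rw [chartExponent_apply, if_pos rfl]
    have := hHo E hEs
    omega

end AlphaStepPure

end Summit.ResolutionOfSingularities.ResolutionOfSingularities.Theorems.LossPolygon
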